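import Summits.ResolutionOfSingularities.ResolutionOfSingularities.Theorems.FrobeniusLadderFInjectiveMacaulayficationDominatingLocFixSupport
import Summits.ResolutionOfSingularities.ResolutionOfSingularities.Theorems.FrobeniusLadderFInjectiveMacaulayficationGoodOverMul
import HarnessLib

/-!
# The CLUSTER-GROWTH STEP in `GoodOver` currency: «improve near `ζ`, pay only inside `Z ∖ U`»
# (crux `FInjectiveMacaulayfication` stmt-ResolutionOfSingularities-15315, chain w45a; res-L1-w45a-plan-1 R16.46 (2) — the quotable one-step
# form assembling res-L1-w45a-stub-1's dominating local fix (c) (p576038), res-L1-w45a-stub-2's support-controlled spread (p576497) and its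
# corollary `DominatingLocFixSupport.exists_dominating_goodOver_nhd_support_subset`, the product base-locality `GoodOverMul.goodOver_mul_diff_support`
# (p575921) and `RelClosedFixR.goodOver_union`; seat res-L1-w45a-lead-1 g7)

[OURS · L1 W4.5a] Support file (`--supports stmt-ResolutionOfSingularities-15315 --as helper`); replaces the role of NO printed item — it is
hole-#3 bookkeeping of OURS; NOT a statement of the manuscript; def-free; CONDITIONAL on `NonFullLocusClosed` (resp. on the two printed
openness theorems BY NAME: Datta–Murayama 2024 Thm. B and the openness of the Cohen–Macaulay locus); AI-written (AI review is weaker than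
expert review).

THE STEP. Data: a nonzero centre `J₀` on the integral finite-type `k`-scheme `X₁` whose blow-ups are good (FULL at non-closed points, CM at
closed points) over a set `S` (the OLD GOOD REGION); a point `ζ` (the residual point to absorb) with germs `c` at `ζ`, `(c) ≠ ⊥`, and
generators `d` of `J₀,ζ·(c)` whose affine blow-up charts are FULL over `𝔪_ζ` (stub-1's DOMINATING = product-compatible local cure at `ζ`,
e.g. `DominatingLocFixLocal.exists_productCompatible_locFix_dimThree` in local dimension 3); and a closed `Z ⊆ X₁` with `(I_Z)_ζ ⊆ √(c)`
(the JUNK REGION one is willing to pay: any closed set containing `V(c)` near `ζ`, typically the closure of `NonReg X₁ ∪ NonInv J₀`).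
Conclusion: an auxiliary centre `J″ ≠ ⊥` with `J″_ζ = (c)` and `supp J″ ⊆ Z`, an open `U ∋ ζ` over which EVERY blow-up along `J₀·J″` is
FULL, and

  `GoodOver p X₁ (J₀ * J″) ((S ∖ Z) ∪ U)`

— the new centre is good over the old good region MINUS the junk region, PLUS the new neighbourhood of `ζ`. Proof: stub-2's corollary gives
`J″, U` with the first five properties and `GoodOver (J₀·J″) U`; off `supp J″ ⊇` nothing of `S ∖ Z` (as `supp J″ ⊆ Z`) the product `J₀·J″`
has the stalks of `J₀`, so its blow-ups are, over `S ∖ Z`, blow-ups along `J₀` (`goodOver_mul_diff_support` + `goodOver_mono`); glue by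
`goodOver_union`. The set identity `(S ∪ U) ∖ (Z ∖ U) = (S ∖ Z) ∪ U` gives the reading «pay only inside `Z ∖ U`» (`clusterGrowth_step'`).
[folklore assembly; cite: DattaMurayama2024, Thm. B; GortzWedhorn2020, Prop. 13.91]
-/

-- single-problem summit: the doubled namespace component is forced
set_option linter.dupNamespace false

noncomputable section

namespace Summit.ResolutionOfSingularities.ResolutionOfSingularities.Theorems.FInjectiveMacaulayfication.ClusterGrowthStep

open CategoryTheory AlgebraicGeometry TopologicalSpace IsLocalRing
open Literature.AlgebraicGeometry.Resolution
open Summit.ResolutionOfSingularities.ResolutionOfSingularities.Theorems.FInjectiveMacaulayfication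
open FCUnguardedAprime SliceableCentre

/-- The set identity behind «pay only inside `Z ∖ U`»: `(S ∪ U) ∖ (Z ∖ U) = (S ∖ Z) ∪ U`. [plumbing] -/
theorem union_diff_diff_eq {α : Type*} (S Z U : Set α) : (S ∪ U) \ (Z \ U) = (S \ Z) ∪ U := by
  ext x
  constructor
  · rintro ⟨hx | hx, hx'⟩
    · by_cases hU : x ∈ U
      · exact Or.inr hU
      · exact Or.inl ⟨hx, fun hZ => hx' ⟨hZ, hU⟩⟩
    · exact Or.inr hx
  · rintro (⟨hS, hZ⟩ | hU)
    · exact ⟨Or.inl hS, fun h => hZ h.1⟩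
    · exact ⟨Or.inr hU, fun h => h.2 hU⟩

/-- **CLUSTER-GROWTH STEP** (R16.46 (2)): given a centre `J₀ ≠ ⊥` good over `S`, a dominating local cure `(c, d)` at `ζ` (charts of
`Bl_{J₀,ζ·(c)}` FULL over `𝔪_ζ`) and a closed junk region `Z` with `(I_Z)_ζ ⊆ √(c)`, there is an auxiliary centre `J″ ≠ ⊥`, `J″_ζ = (c)`,
`supp J″ ⊆ Z`, and an open `U ∋ ζ` with every blow-up along `J₀·J″` FULL over `U` and `GoodOver p X₁ (J₀·J″) ((S ∖ Z) ∪ U)`.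
[OURS · conditional on `NonFullLocusClosed`] [cite: DattaMurayama2024, Thm. B] -/
theorem clusterGrowth_step (hNF : NonFullLocusClosed.NonFullLocusClosed)
    (p : ℕ) (hp : p.Prime) (k : Type) [Field k] [CharP k p] (X₁ : Scheme.{0}) (f₁ : X₁ ⟶ Spec (.of k))
    [LocallyOfFiniteType f₁] [QuasiCompact f₁] [IsIntegral X₁]
    (J₀ : X₁.IdealSheafData) (hJ₀ : J₀ ≠ ⊥) (S : Set X₁) (hS : GoodOver p X₁ J₀ S)
    (ζ : X₁) {m : ℕ} (c : Fin m → X₁.presheaf.stalk ζ)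
    (hc0 : Ideal.span (Set.range c) ≠ ⊥) {n : ℕ} (d : Fin n → X₁.presheaf.stalk ζ)
    (hd : Ideal.span (Set.range d) = stalkIdeal J₀ ζ * Ideal.span (Set.range c))
    (hfull : ∀ (j : Fin n) (𝔔 : PrimeSpectrum (blowupAlgebra (Ideal.span (Set.range d)) (d j))),
      𝔔.asIdeal.comap (algebraMap (X₁.presheaf.stalk ζ) (blowupAlgebra (Ideal.span (Set.range d)) (d j))) =
        maximalIdeal (X₁.presheaf.stalk ζ) → FullCl p (Localization.AtPrime 𝔔.asIdeal))
    (Z : Set X₁) (hZ : IsClosed Z)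
    (hrad : stalkIdeal (Scheme.IdealSheafData.vanishingIdeal ⟨Z, hZ⟩) ζ ≤ (Ideal.span (Set.range c)).radical) :
    ∃ (J'' : X₁.IdealSheafData) (U : X₁.Opens), J'' ≠ ⊥ ∧ stalkIdeal J'' ζ = Ideal.span (Set.range c) ∧ (J''.support : Set X₁) ⊆ Z ∧
      ζ ∈ (U : Set X₁) ∧
      (∀ (X₂ : Scheme.{0}) (π : X₂ ⟶ X₁), IsBlowup π (J₀ * J'') → ∀ x : X₂, π.base x ∈ (U : Set X₁) → FullCl p (X₂.presheaf.stalk x)) ∧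
      GoodOver p X₁ (J₀ * J'') ((S \ Z) ∪ (U : Set X₁)) := by
  classical
  haveI : IsNoetherian X₁ := ClosedPointsOfClosedFinite.isNoetherian_of_locallyOfFiniteType_of_quasiCompact f₁
  haveI : JacobsonSpace X₁ := LocallyOfFiniteType.jacobsonSpace f₁
  obtain ⟨J'', U, hJ'', hJ''ζ, hJ''Z, hζU, hU, hgood⟩ :=
    DominatingLocFixSupport.exists_dominating_goodOver_nhd_support_subset hNF p hp k X₁ f₁ J₀ hJ₀ ζ c hc0 d hd hfull Z hZ hrad
  refine ⟨J'', U, hJ'', hJ''ζ, hJ''Z, hζU, hU, ?_⟩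
  -- over `S ∖ Z ⊆ S ∖ supp J″` the product has the stalks of `J₀`: base locality
  have hsub : S \ Z ⊆ S \ (J''.support : Set X₁) := fun x hx => ⟨hx.1, fun h => hx.2 (hJ''Z h)⟩
  have h1 : GoodOver p X₁ (J₀ * J'') (S \ Z) :=
    RelClosedSubsetFixFinite.goodOver_mono hsub (GoodOverMul.goodOver_mul_diff_support hS)
  exact RelClosedFixR.goodOver_union h1 hgood

/-- **CLUSTER-GROWTH STEP, «pay only inside `Z ∖ U`» form**: same data; the new centre `J₀·J″` is good over `(S ∪ U) ∖ (Z ∖ U)`.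
[OURS · conditional on `NonFullLocusClosed`] [cite: DattaMurayama2024, Thm. B] -/
theorem clusterGrowth_step' (hNF : NonFullLocusClosed.NonFullLocusClosed)
    (p : ℕ) (hp : p.Prime) (k : Type) [Field k] [CharP k p] (X₁ : Scheme.{0}) (f₁ : X₁ ⟶ Spec (.of k))
    [LocallyOfFiniteType f₁] [QuasiCompact f₁] [IsIntegral X₁]
    (J₀ : X₁.IdealSheafData) (hJ₀ : J₀ ≠ ⊥) (S : Set X₁) (hS : GoodOver p X₁ J₀ S)
    (ζ : X₁) {m : ℕ} (c : Fin m → X₁.presheaf.stalk ζ)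
    (hc0 : Ideal.span (Set.range c) ≠ ⊥) {n : ℕ} (d : Fin n → X₁.presheaf.stalk ζ)
    (hd : Ideal.span (Set.range d) = stalkIdeal J₀ ζ * Ideal.span (Set.range c))
    (hfull : ∀ (j : Fin n) (𝔔 : PrimeSpectrum (blowupAlgebra (Ideal.span (Set.range d)) (d j))),
      𝔔.asIdeal.comap (algebraMap (X₁.presheaf.stalk ζ) (blowupAlgebra (Ideal.span (Set.range d)) (d j))) =
        maximalIdeal (X₁.presheaf.stalk ζ) → FullCl p (Localization.AtPrime 𝔔.asIdeal))
    (Z : Set X₁) (hZ : IsClosed Z)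
    (hrad : stalkIdeal (Scheme.IdealSheafData.vanishingIdeal ⟨Z, hZ⟩) ζ ≤ (Ideal.span (Set.range c)).radical) :
    ∃ (J'' : X₁.IdealSheafData) (U : X₁.Opens), J'' ≠ ⊥ ∧ stalkIdeal J'' ζ = Ideal.span (Set.range c) ∧ (J''.support : Set X₁) ⊆ Z ∧
      ζ ∈ (U : Set X₁) ∧
      (∀ (X₂ : Scheme.{0}) (π : X₂ ⟶ X₁), IsBlowup π (J₀ * J'') → ∀ x : X₂, π.base x ∈ (U : Set X₁) → FullCl p (X₂.presheaf.stalk x)) ∧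
      GoodOver p X₁ (J₀ * J'') ((S ∪ (U : Set X₁)) \ (Z \ (U : Set X₁))) := by
  obtain ⟨J'', U, hJ'', hJ''ζ, hJ''Z, hζU, hU, hgood⟩ :=
    clusterGrowth_step hNF p hp k X₁ f₁ J₀ hJ₀ S hS ζ c hc0 d hd hfull Z hZ hrad
  refine ⟨J'', U, hJ'', hJ''ζ, hJ''Z, hζU, hU, ?_⟩
  rw [union_diff_diff_eq]
  exact hgood

/-- **CLUSTER-GROWTH STEP from the two printed openness theorems BY NAME** (Datta–Murayama 2024 Thm. B: the F-injective locus is open;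
openness of the Cohen–Macaulay locus). [OURS · conditional-result] [cite: DattaMurayama2024, Thm. B] -/
theorem clusterGrowth_step_of_DM_CMLocusOpen
    (hDM : Literature.AlgebraicGeometry.Resolution.DattaMurayama2024_fInjectiveLocusOpen.{0})
    (hCMo : NonFullLocusClosed.CMLocusOpen)
    (p : ℕ) (hp : p.Prime) (k : Type) [Field k] [CharP k p] (X₁ : Scheme.{0}) (f₁ : X₁ ⟶ Spec (.of k))
    [LocallyOfFiniteType f₁] [QuasiCompact f₁] [IsIntegral X₁]
    (J₀ : X₁.IdealSheafData) (hJ₀ : J₀ ≠ ⊥) (S : Set X₁) (hS : GoodOver p X₁ J₀ S)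
    (ζ : X₁) {m : ℕ} (c : Fin m → X₁.presheaf.stalk ζ)
    (hc0 : Ideal.span (Set.range c) ≠ ⊥) {n : ℕ} (d : Fin n → X₁.presheaf.stalk ζ)
    (hd : Ideal.span (Set.range d) = stalkIdeal J₀ ζ * Ideal.span (Set.range c))
    (hfull : ∀ (j : Fin n) (𝔔 : PrimeSpectrum (blowupAlgebra (Ideal.span (Set.range d)) (d j))),
      𝔔.asIdeal.comap (algebraMap (X₁.presheaf.stalk ζ) (blowupAlgebra (Ideal.span (Set.range d)) (d j))) =
        maximalIdeal (X₁.presheaf.stalk ζ) → FullCl p (Localization.AtPrime 𝔔.asIdeal))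
    (Z : Set X₁) (hZ : IsClosed Z)
    (hrad : stalkIdeal (Scheme.IdealSheafData.vanishingIdeal ⟨Z, hZ⟩) ζ ≤ (Ideal.span (Set.range c)).radical) :
    ∃ (J'' : X₁.IdealSheafData) (U : X₁.Opens), J'' ≠ ⊥ ∧ stalkIdeal J'' ζ = Ideal.span (Set.range c) ∧ (J''.support : Set X₁) ⊆ Z ∧
      ζ ∈ (U : Set X₁) ∧
      (∀ (X₂ : Scheme.{0}) (π : X₂ ⟶ X₁), IsBlowup π (J₀ * J'') → ∀ x : X₂, π.base x ∈ (U : Set X₁) → FullCl p (X₂.presheaf.stalk x)) ∧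
      GoodOver p X₁ (J₀ * J'') ((S \ Z) ∪ (U : Set X₁)) :=
  clusterGrowth_step (NonFullLocusClosed.nonFullLocusClosed_of_named hDM hCMo)
    p hp k X₁ f₁ J₀ hJ₀ S hS ζ c hc0 d hd hfull Z hZ hrad

end Summit.ResolutionOfSingularities.ResolutionOfSingularities.Theorems.FInjectiveMacaulayfication.ClusterGrowthStep

end
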